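import Summits.BirchSwinnertonDyer.Rank2.LevelFifteenDescentParity
import Summits.BirchSwinnertonDyer.Rank2.LevelFifteenTwoAdicCoefficientsTop
import Summits.BirchSwinnertonDyer.Rank2.KubotaLeopoldtTwoInvRiemannSums
import Summits.BirchSwinnertonDyer.Rank1Residual.X1.MuLambdaAlgebra
import HarnessLib

/-!
# The BC5 rung inputs in the line's currency: `red (pfree L₀)`, `red (pfree G₀)`, `red (pfree G₀^ι)` modulo `T⁸` for `15A8`

Cell `bsd-rank2` (D-0036), seat `bsd-rank2-eng` GEN 9 (director-bsd g9 ruling (R3): BC5 rung «(★_S) mod T⁸ on 15A8», line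
`star`, crux E1M stmt-BirchSwinnertonDyer-20341; Stage D, inputs). The line states (★-core) through
`MuLambda.red (MuLambda.pfree ·)` of integral multiples `L₀` of `L₂(f, α)`, `G₀` of `G = klTwoNumerator` and `G₀^ι` of
`klTwoNumeratorInv`. Parts VI–VII and the Kubota–Leopoldt companions give the coefficients of `L₂/2`, `G/2`, `G^ι/2` modulo `2`
as `ℚ₂`-norm statements; part VIII gives `u = L₂/2 ∈ Λˣ`. Here the translation:

* `coeff_red_pfree_of_unit_multiple` (generic): if `u ∈ Λˣ` with `ι u = ½·L`, `L₀ ≠ 0` with `ι L₀ = c·L`, and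
  `‖L_k/2 − t‖ < 1` for some `t ∈ ℤ₂`, then `[T^k] red(pfree L₀) = t mod 2` (`L₀ = 2^a·v·u`, `pfree L₀ = v·u`, `v̄ = 1`);
* **`red_pfree_refFifteen`**: for every newform `f` of `[1,1,1,0,0]` and every nonzero `L₀ ∈ Λ` with `ι L₀ = c·L₂(f, α)`:
  `red(pfree L₀) ≡ 1 + T³ + T⁴ + T⁶ (mod T⁸)` (coefficientwise: `[T^k] = b_k`, `b = 1,0,0,1,1,0,1,0`);
* **`red_pfree_klTwo`**, **`red_pfree_klTwoInv`**: for every nonzero `G₀` with `ι G₀ = c·G` (resp. `c·G^ι`):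
  `red(pfree G₀) ≡ 1 + T² + T⁵ + T⁷`, `red(pfree G₀^ι) ≡ 1 + T² + T⁴ + T⁵ (mod T⁸)`.

THEOREMS ONLY (no definition, no named fact, no `sorry`). PARTITION: none — r_an ≥ 2, summit axis S0; TWIN (D-0056): n/a.
B1 honesty: finite `2`-adic arithmetic on tree objects; nothing here reads an analytic rank; no S0 motion.

References: B. Mazur, J. Tate, J. Teitelbaum, *Invent. Math.* 84 (1986) §I.12–§I.13 [MazurTateTeitelbaum1986Invent];
L. C. Washington, *Introduction to cyclotomic fields* (1997) §7.1, §13.1 [Washington1997].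
-/

noncomputable section

open scoped MatrixGroups ModularForm

open CongruenceSubgroup Literature.NumberTheory.EllipticCurves Literature.NumberTheory.EllipticCurves.ModularForms
open Summit.BirchSwinnertonDyer.Rank1Residual.X1

namespace Summit.BirchSwinnertonDyer.Rank2.LevelFifteen

/-! ### §1 The residue field of `ℤ₂` and the generic translation -/

/-- In `ℤ₂/2ℤ₂ ≅ 𝔽₂` every nonzero element is `1`. [folklore] -/
theorem residueField_two_eq_one_of_ne_zero {x : IsLocalRing.ResidueField ℤ_[2]} (hx : x ≠ 0) : x = 1 := by
  have key : ∀ y : ZMod 2, y ≠ 0 → y = 1 := by decide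
  have h := key (PadicInt.residueField x) (by
    intro h0; exact hx (by simpa using congrArg (PadicInt.residueField (p := 2)).symm h0))
  have := congrArg (PadicInt.residueField (p := 2)).symm h
  simpa using this

/-- The residue of a unit of `ℤ₂` is `1`. [folklore] -/
theorem residue_eq_one_of_isUnit {v : ℤ_[2]} (hv : IsUnit v) : IsLocalRing.residue ℤ_[2] v = 1 :=
  residueField_two_eq_one_of_ne_zero ((IsLocalRing.residue_ne_zero_iff_isUnit v).mpr hv)

/-- Elements of `ℤ₂` that are close in `ℚ₂` have the same residue. [folklore] -/
theorem residue_eq_of_norm_sub_lt_one {x t : ℤ_[2]} (h : ‖(x : ℚ_[2]) - (t : ℚ_[2])‖ < 1) :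
    IsLocalRing.residue ℤ_[2] x = IsLocalRing.residue ℤ_[2] t := by
  rw [← sub_eq_zero, ← map_sub, IsLocalRing.residue_eq_zero_iff, IsLocalRing.mem_maximalIdeal, PadicInt.mem_nonunits,
    PadicInt.norm_def]
  push_cast
  exact h

/-- **Generic translation into the `red ∘ pfree` currency.** Let `u ∈ Λˣ` with `ι u = ½·L`, `L₀ ∈ Λ ∖ {0}` with
`ι L₀ = c·L`, and `‖L_k/2 − t‖ < 1` for some `t ∈ ℤ₂`. Then `[T^k] red(pfree L₀) = t mod 2`. Proof: `L₀·u⁻¹ = C d'`,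
`d' = 2^a·v` (`v ∈ ℤ₂ˣ`), `pfree L₀ = v·u` (`MuLambda.mu_eq_and_pfree_eq`), `v̄ = 1`, `ū_k = t̄`.
[cite: Washington1997, §7.1] [cite: MazurTateTeitelbaum1986Invent, §I.12] -/
theorem coeff_red_pfree_of_unit_multiple {u : IwasawaAlgebra 2} (hu : IsUnit u) {L : PowerSeries ℚ_[2]}
    (hι : iwasawaToPowerSeries 2 u = PowerSeries.C ((2 : ℚ_[2])⁻¹) * L)
    {c : ℚ_[2]} {L₀ : IwasawaAlgebra 2} (hL₀ : L₀ ≠ 0)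
    (hmult : iwasawaToPowerSeries 2 L₀ = PowerSeries.C c * L)
    {k : ℕ} {t : ℤ_[2]} (ht : ‖PowerSeries.coeff k L / 2 - (t : ℚ_[2])‖ < 1) :
    PowerSeries.coeff k (MuLambda.red (MuLambda.pfree L₀)) = IsLocalRing.residue ℤ_[2] t := by
  obtain ⟨w, rfl⟩ := hu
  -- `L = 2·ι(w)` and `ι(L₀ · w⁻¹) = C (2c)`
  have hL : L = PowerSeries.C (2 : ℚ_[2]) * iwasawaToPowerSeries 2 (w : IwasawaAlgebra 2) := by
    rw [hι, ← mul_assoc, ← map_mul, mul_inv_cancel₀ two_ne_zero, map_one, one_mul]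
  have hprod : iwasawaToPowerSeries 2 (L₀ * ↑w⁻¹) = PowerSeries.C (c * 2) := by
    rw [map_mul, hmult, hL, ← mul_assoc, ← map_mul, mul_assoc, ← map_mul, Units.mul_inv, map_one, mul_one]
  set d' : ℤ_[2] := PowerSeries.coeff 0 (L₀ * ↑w⁻¹) with hd'def
  have hd' : algebraMap ℤ_[2] ℚ_[2] d' = c * 2 := by
    have h := congrArg (PowerSeries.coeff 0) hprod
    rwa [PowerSeries.coeff_map, PowerSeries.coeff_zero_C] at h
  have h1 : L₀ * ↑w⁻¹ = PowerSeries.C d' := by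
    apply iwasawaToPowerSeries_injective 2
    rw [hprod, ← hd']
    simp [iwasawaToPowerSeries]
  have hfac : L₀ = PowerSeries.C d' * ↑w := by
    rw [← h1, Units.inv_mul_cancel_right]
  have hd'0 : d' ≠ 0 := by
    rintro h; apply hL₀; rw [hfac, h, map_zero, zero_mul]
  -- `d' = v · 2^a`, `v` a unit
  have hsp := PadicInt.unitCoeff_spec hd'0
  have hdec : L₀ = PowerSeries.C (((2 : ℕ) : ℤ_[2]) ^ d'.valuation) *
      (PowerSeries.C ((PadicInt.unitCoeff hd'0 : ℤ_[2])) * ↑w) := by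
    rw [hfac]
    conv_lhs => rw [hsp]
    rw [map_mul, ← mul_assoc, mul_comm (PowerSeries.C _) (PowerSeries.C _)]
  have hunit : IsUnit (PowerSeries.C ((PadicInt.unitCoeff hd'0 : ℤ_[2])) * (w : IwasawaAlgebra 2)) :=
    ((PadicInt.unitCoeff hd'0).isUnit.map PowerSeries.C).mul w.isUnit
  have hred : MuLambda.red (PowerSeries.C ((PadicInt.unitCoeff hd'0 : ℤ_[2])) * (w : IwasawaAlgebra 2)) ≠ 0 :=
    (hunit.map (PowerSeries.map (IsLocalRing.residue ℤ_[2]))).ne_zero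
  obtain ⟨-, hpf⟩ := MuLambda.mu_eq_and_pfree_eq hred hdec
  rw [hpf]
  -- coefficients of `red (C v * w)`
  rw [MuLambda.red, map_mul, PowerSeries.map_C, PowerSeries.coeff_C_mul, PowerSeries.coeff_map,
    residue_eq_one_of_isUnit (PadicInt.unitCoeff hd'0).isUnit, one_mul]
  -- `ū_k = t̄`: `ι(w)_k = L_k / 2`
  refine residue_eq_of_norm_sub_lt_one ?_
  have hcoef : ((PowerSeries.coeff k (w : IwasawaAlgebra 2) : ℤ_[2]) : ℚ_[2]) = PowerSeries.coeff k L / 2 := by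
    have h := congrArg (PowerSeries.coeff k) hι
    rw [PowerSeries.coeff_map, PowerSeries.coeff_C_mul] at h
    rw [show (algebraMap ℤ_[2] ℚ_[2]) (PowerSeries.coeff k (w : IwasawaAlgebra 2)) =
      ((PowerSeries.coeff k (w : IwasawaAlgebra 2) : ℤ_[2]) : ℚ_[2]) from rfl] at h
    rw [h]; ring
  rw [hcoef]; exact ht

/-- `residue (σ·b) = residue b` for `σ = ±1` (`−1 ≡ 1 (mod 2)`). [folklore] -/
theorem residue_sign_mul {σ : ℤ} (hσ : σ = 1 ∨ σ = -1) (b : ℤ) :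
    IsLocalRing.residue ℤ_[2] ((σ * b : ℤ) : ℤ_[2]) = IsLocalRing.residue ℤ_[2] (b : ℤ_[2]) := by
  rcases hσ with rfl | rfl
  · simp
  · have hneg : IsLocalRing.residue ℤ_[2] ((-1 : ℤ) : ℤ_[2]) = 1 :=
      residue_eq_one_of_isUnit (by push_cast; exact isUnit_one.neg)
    push_cast at hneg ⊢
    rw [map_mul, hneg, one_mul]

/-! ### §2 The curve side: `red(pfree L₀) ≡ 1 + T³ + T⁴ + T⁶ (mod T⁸)` for `15A8` -/

/-- **`red(pfree L₀)` modulo `T⁸` for the integral multiples of `L₂(15A8, α)`**: `[T^k] red(pfree L₀) = b_k mod 2` with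
`b = 1,0,0,1,1,0,1,0` — for EVERY nonzero `L₀ ∈ Λ` with `ι L₀ = c·L₂(f, α)`, `f` any newform of `[1,1,1,0,0]`.
[cite: MazurTateTeitelbaum1986Invent, §I.12–§I.13] -/
theorem red_pfree_refFifteen (hmin : (⟨1, 1, 1, 0, 0⟩ : WeierstrassCurve ℚ).IsGloballyMinimal)
    ⦃N : ℕ⦄ [NeZero N] (f : CuspForm (Gamma0 N) 2) (hW : IsNewformOf (⟨1, 1, 1, 0, 0⟩ : WeierstrassCurve ℚ) f)
    (c : ℚ) (L₀ : IwasawaAlgebra 2) (hL₀ : L₀ ≠ 0)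
    (hι : iwasawaToPowerSeries 2 L₀ = PowerSeries.C (c : ℚ_[2]) *
      padicLFunction f (@unitRoot (⟨1, 1, 1, 0, 0⟩ : WeierstrassCurve ℚ) hmin 2 _ : ℚ_[2])) :
    ∀ kb ∈ [((0 : ℕ), (1 : ℤ)), (1, 0), (2, 0), (3, 1), (4, 1), (5, 0), (6, 1), (7, 0)],
      PowerSeries.coeff kb.1 (MuLambda.red (MuLambda.pfree L₀)) = IsLocalRing.residue ℤ_[2] (kb.2 : ℤ_[2]) := by
  obtain ⟨u, hu, hιu⟩ := refFifteen_exists_isUnit_iwasawa hmin hW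
  obtain ⟨σ, hσ, h0, hbits⟩ := padicLCoeff_refFifteen_mod_four hmin f hW
  obtain ⟨σ', hσ', h0', hbits'⟩ := padicLCoeff_refFifteen_mod_four_top hmin f hW
  have hσσ : σ' = σ := by
    have : (σ' : ℚ) = σ := by linarith [h0.symm.trans h0']
    exact_mod_cast this
  subst hσσ
  -- each bit: `‖c_k/2 − σ b_k‖ ≤ 1/2 < 1`
  have step : ∀ (k : ℕ) (b : ℤ),
      ‖padicLCoeff f (@unitRoot (⟨1, 1, 1, 0, 0⟩ : WeierstrassCurve ℚ) hmin 2 _ : ℚ_[2]) k / 2 - σ' * b‖ ≤ (2 : ℝ)⁻¹ →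
      PowerSeries.coeff k (MuLambda.red (MuLambda.pfree L₀)) = IsLocalRing.residue ℤ_[2] (b : ℤ_[2]) := by
    intro k b hk
    rw [← residue_sign_mul hσ' b]
    refine coeff_red_pfree_of_unit_multiple hu hιu hL₀ hι ?_
    rw [coeff_padicLFunction]
    push_cast
    linarith [hk]
  intro kb hkb
  simp only [List.mem_cons, List.mem_nil_iff, or_false] at hkb
  rcases hkb with rfl | rfl | rfl | rfl | rfl | rfl | rfl | rfl
  · exact step 0 1 (by simpa using hbits (0, 1) (by simp))
  · exact step 1 0 (by simpa using hbits (1, 0) (by simp))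
  · exact step 2 0 (by simpa using hbits (2, 0) (by simp))
  · exact step 3 1 (by simpa using hbits (3, 1) (by simp))
  · exact step 4 1 (by simpa using hbits (4, 1) (by simp))
  · exact step 5 0 (by simpa using hbits (5, 0) (by simp))
  · exact step 6 1 (by simpa using hbits' (6, 1) (by simp))
  · exact step 7 0 (by simpa using hbits' (7, 0) (by simp))

/-! ### §3 The Kubota–Leopoldt side: `red(pfree G₀)`, `red(pfree G₀^ι)` modulo `T⁸` -/

/-- **`red(pfree G₀) ≡ 1 + T² + T⁵ + T⁷ (mod T⁸)`** for every nonzero `G₀ ∈ Λ` with `ι G₀ = c·G`.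
[cite: MazurTateTeitelbaum1986Invent, §I.12–§I.13] -/
theorem red_pfree_klTwo (c : ℚ_[2]) (G₀ : IwasawaAlgebra 2) (hG₀ : G₀ ≠ 0)
    (hι : iwasawaToPowerSeries 2 G₀ = PowerSeries.C c * klTwoNumerator) :
    ∀ kb ∈ [((0 : ℕ), (1 : ℤ)), (1, 0), (2, 1), (3, 0), (4, 0), (5, 1), (6, 0), (7, 1)],
      PowerSeries.coeff kb.1 (MuLambda.red (MuLambda.pfree G₀)) = IsLocalRing.residue ℤ_[2] (kb.2 : ℤ_[2]) := by
  obtain ⟨g, hg, hg1⟩ := exists_iwasawa_half_klTwoNumerator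
  have hu : IsUnit g := PowerSeries.isUnit_iff_constantCoeff.mpr (by rw [hg1]; exact isUnit_one)
  intro kb hkb
  have hk := coeff_klTwoNumerator_mod_four kb hkb
  refine coeff_red_pfree_of_unit_multiple hu hg hG₀ hι (t := (kb.2 : ℤ_[2])) ?_
  push_cast
  linarith [hk]

/-- **`red(pfree G₀^ι) ≡ 1 + T² + T⁴ + T⁵ (mod T⁸)`** for every nonzero `GI₀ ∈ Λ` with `ι GI₀ = c·G^ι`.
[cite: MazurTateTeitelbaum1986Invent, §I.12–§I.13] -/
theorem red_pfree_klTwoInv (c : ℚ_[2]) (G₀ : IwasawaAlgebra 2) (hG₀ : G₀ ≠ 0)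
    (hι : iwasawaToPowerSeries 2 G₀ = PowerSeries.C c * klTwoNumeratorInv) :
    ∀ kb ∈ [((0 : ℕ), (1 : ℤ)), (1, 0), (2, 1), (3, 0), (4, 1), (5, 1), (6, 0), (7, 0)],
      PowerSeries.coeff kb.1 (MuLambda.red (MuLambda.pfree G₀)) = IsLocalRing.residue ℤ_[2] (kb.2 : ℤ_[2]) := by
  obtain ⟨g, hg, hg1⟩ := exists_iwasawa_half_klTwoNumeratorInv
  have hu : IsUnit g := PowerSeries.isUnit_iff_constantCoeff.mpr (by rw [hg1]; exact isUnit_one)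
  intro kb hkb
  have hk := coeff_klTwoNumeratorInv_mod_four kb hkb
  refine coeff_red_pfree_of_unit_multiple hu hg hG₀ hι (t := (kb.2 : ℤ_[2])) ?_
  push_cast
  linarith [hk]

end Summit.BirchSwinnertonDyer.Rank2.LevelFifteen

end
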